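import Summits.QuantumFields.YangMills.Theorems.AllWindowsColdBoxPlaqCostCubicTaylor
import Summits.QuantumFields.YangMills.Theorems.AllWindowsColdBoxBoxMidWindowsSU22LineDefs
import Summits.QuantumFields.YangMills.Theorems.EquipartitionCriticalityFreeEnergyLogCoefficientExpChartBasic
import Summits.QuantumFields.YangMills.Theorems.WeakCouplingRatesColdBoxDirichletLargeField
import Literature.MathematicalPhysics.QuantumLattice.RepLieAlgebraUnitary
import HarnessLib

/-!
# LINE-17 «hypercontractive second-order tilt expansion» on crux `AllWindowsColdBox.BoxMidWindowsSU22` (stmt-QuantumFields-24003):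
# local ingredients of stub F `stub_gaussSideTerms` (STUB-PLAN-E §5), part A: three colours and parity

The Gaussian-side terms F(i)–(iii) of LINE-17 concern `obsF`, `obsG` = `β·cost` of ONE plaquette each.  On the small-field event,
E(0) (`abs_qObsD_sub_beta_mul_plaqCostAt_sub_cubic_le`) writes `β·cost_{(x,1,2)} = qObsD − c_x + O(r_x)` with the LOCAL cubic term
`c_x = β·½(T(s,a₁,a₂) − T(s,a₁,a₃) − T(s,a₁,a₄) − T(s,a₂,a₃) − T(s,a₂,a₄) + T(s,a₃,a₄))` of the four legs.  This file (def-free):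

* **`dimE_rho2_eq_three : dimE ρ₂ = 3`** — the `¾` of `GaussSideTerms`/`CoreBound` is `(dimE ρ₂)/4` of the tree's colour identity
  `cov_qObsD_gaussD_eq` (via `dimE_eq_finrank` and `Literature…finrank_matrixLieAlgebra_specialUnitaryGroup`, `2² − 1 = 3`);
* parity for `integral_gaussD_even_mul_odd`: `unscaleTE`, the chart coordinates `extZero ∘ unscaleTE`, the linear circulation and the
  local cubic term are ODD in `t` (`localCubic_neg`); the quadratic surrogate `qObsD` of a plaquette is EVEN (`qObsD_neg`).

Part B (`…GaussSideLocalMoments`) has the one-leg Gaussian moments and the `L⁴`/`L²` bounds of `c_x` and `r_x`.  No definition; standard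
axioms.  HONEST LABEL: helper toward the OPEN registered stub F of one critic-PASSed line on the R2ξ″ RECORD-rung crux 24003; no stub by
name, no crux, rung or summit; the Yang–Mills mass gap is NOT proved by this file.
-/

set_option autoImplicit false

noncomputable section

open MeasureTheory ProbabilityTheory Finset
open scoped Matrix Matrix.Norms.Frobenius
open Literature.MathematicalPhysics.QuantumLattice
open Literature.MathematicalPhysics.QuantumFieldTheory
open Literature.MathematicalPhysics.QuantumFieldTheory.LatticeMaxwell
open Summit.QuantumFields.YangMills.Theorems.WeakCouplingRates
open Summit.QuantumFields.YangMills.Theorems.ColdBoxAllGroups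
open Summit.QuantumFields.YangMills.Theorems.FreeEnergyLogCoefficient

namespace Summit.QuantumFields.YangMills.Theorems.AllWindowsColdBoxBoxMidLine

/-! ## §0 Three colours: `dimE ρ₂ = 3` -/

/-- **The chart dimension of the fundamental representation of `SU(2)` is `3`** (`dimE = dim_ℝ 𝔤_ρ` for unitary `ρ`,
`𝔤 = 𝔰𝔲(2)`, `dim 𝔰𝔲(N) = N² − 1`). This is the `3` of `¾·boxDirCircSqCov` in `GaussSideTerms`/`CoreBound` (`(D/4)·boxDirCircSqCov`,
`cov_qObsD_gaussD_eq`). -/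
theorem dimE_rho2_eq_three : dimE ρ₂ = 3 := by
  rw [dimE_eq_finrank ρ₂ fundamentalRep_mem_unitaryGroup]
  have hr : Set.range (ρ₂ : SU2 → Matrix (Fin 2) (Fin 2) ℂ) = (Matrix.specialUnitaryGroup (Fin 2) ℂ : Set (Matrix (Fin 2) (Fin 2) ℂ)) :=
    Subtype.range_coe
  rw [hr, Literature.MathematicalPhysics.QuantumLattice.finrank_matrixLieAlgebra_specialUnitaryGroup, Fintype.card_fin]
  norm_num

/-! ## §2 The local cubic term and the quartic remainder of ONE plaquette `(x, 1, 2)` -/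

section Local

variable {H : ℕ}

/-- `unscaleTE` is odd (linear). -/
theorem unscaleTE_neg (D : ℕ) (β : ℝ) (t : TSpaceD H D) : unscaleTE H D β (-t) = -unscaleTE H D β t := by
  funext e
  ext i
  simp [unscaleTE_apply, neg_div]

/-- The chart coordinates are odd in `t`. -/
theorem extZero_unscaleTE_neg (D : ℕ) (β : ℝ) (t : TSpaceD H D) (e : Literature.MathematicalPhysics.QuantumLattice.ZdEdge 4) :
    extZero (unscaleTE H D β (-t)) e = -extZero (unscaleTE H D β t) e := by
  rw [unscaleTE_neg, show -unscaleTE H D β t = fun f => -(unscaleTE H D β t f) from rfl,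
    ← map_extZero (fun v : EuclideanSpace ℝ (Fin D) => -v) neg_zero]

/-- The linear circulation is odd in `t`. -/
theorem circV_extZero_unscaleTE_neg (D : ℕ) (β : ℝ) (t : TSpaceD H D) (q : Plaq 4) :
    circV (extZero (unscaleTE H D β (-t))) q = -circV (extZero (unscaleTE H D β t)) q := by
  unfold circV
  simp only [extZero_unscaleTE_neg]
  abel

/-- The cubic form is odd under the joint sign flip: `T(−a,−b,−c) = −T(a,b,c)`. -/
theorem chartCubic_neg_neg_neg (a b c : EuclideanSpace ℝ (Fin (dimE ρ₂))) :
    chartCubic ρ₂ (-a) (-b) (-c) = -chartCubic ρ₂ a b c := by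
  rw [show -a = (-1 : ℝ) • a by simp, chartCubic_smul_left, chartCubic_neg_mid, chartCubic_neg_right]
  ring

/-- **The local cubic term of the plaquette `(x,1,2)` is odd in `t`** (so its `gaussD`-integral against any even function vanishes:
`integral_gaussD_even_mul_odd`). -/
theorem localCubic_neg (x : Literature.Probability.LatticeModels.Site 4) (β : ℝ) (t : TSpaceD H (dimE ρ₂)) :
    β * ((chartCubic ρ₂ (circV (extZero (unscaleTE H (dimE ρ₂) β (-t))) (x, 1, 2)) (extZero (unscaleTE H (dimE ρ₂) β (-t)) (x, 1))
            (extZero (unscaleTE H (dimE ρ₂) β (-t)) (x + Pi.single 1 1, 2)) -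
          chartCubic ρ₂ (circV (extZero (unscaleTE H (dimE ρ₂) β (-t))) (x, 1, 2)) (extZero (unscaleTE H (dimE ρ₂) β (-t)) (x, 1))
            (extZero (unscaleTE H (dimE ρ₂) β (-t)) (x + Pi.single 2 1, 1)) -
          chartCubic ρ₂ (circV (extZero (unscaleTE H (dimE ρ₂) β (-t))) (x, 1, 2)) (extZero (unscaleTE H (dimE ρ₂) β (-t)) (x, 1))
            (extZero (unscaleTE H (dimE ρ₂) β (-t)) (x, 2)) -
          chartCubic ρ₂ (circV (extZero (unscaleTE H (dimE ρ₂) β (-t))) (x, 1, 2)) (extZero (unscaleTE H (dimE ρ₂) β (-t)) (x + Pi.single 1 1, 2))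
            (extZero (unscaleTE H (dimE ρ₂) β (-t)) (x + Pi.single 2 1, 1)) -
          chartCubic ρ₂ (circV (extZero (unscaleTE H (dimE ρ₂) β (-t))) (x, 1, 2)) (extZero (unscaleTE H (dimE ρ₂) β (-t)) (x + Pi.single 1 1, 2))
            (extZero (unscaleTE H (dimE ρ₂) β (-t)) (x, 2)) +
          chartCubic ρ₂ (circV (extZero (unscaleTE H (dimE ρ₂) β (-t))) (x, 1, 2)) (extZero (unscaleTE H (dimE ρ₂) β (-t)) (x + Pi.single 2 1, 1))
            (extZero (unscaleTE H (dimE ρ₂) β (-t)) (x, 2))) / 2) =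
      -(β * ((chartCubic ρ₂ (circV (extZero (unscaleTE H (dimE ρ₂) β t)) (x, 1, 2)) (extZero (unscaleTE H (dimE ρ₂) β t) (x, 1))
            (extZero (unscaleTE H (dimE ρ₂) β t) (x + Pi.single 1 1, 2)) -
          chartCubic ρ₂ (circV (extZero (unscaleTE H (dimE ρ₂) β t)) (x, 1, 2)) (extZero (unscaleTE H (dimE ρ₂) β t) (x, 1))
            (extZero (unscaleTE H (dimE ρ₂) β t) (x + Pi.single 2 1, 1)) -
          chartCubic ρ₂ (circV (extZero (unscaleTE H (dimE ρ₂) β t)) (x, 1, 2)) (extZero (unscaleTE H (dimE ρ₂) β t) (x, 1))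
            (extZero (unscaleTE H (dimE ρ₂) β t) (x, 2)) -
          chartCubic ρ₂ (circV (extZero (unscaleTE H (dimE ρ₂) β t)) (x, 1, 2)) (extZero (unscaleTE H (dimE ρ₂) β t) (x + Pi.single 1 1, 2))
            (extZero (unscaleTE H (dimE ρ₂) β t) (x + Pi.single 2 1, 1)) -
          chartCubic ρ₂ (circV (extZero (unscaleTE H (dimE ρ₂) β t)) (x, 1, 2)) (extZero (unscaleTE H (dimE ρ₂) β t) (x + Pi.single 1 1, 2))
            (extZero (unscaleTE H (dimE ρ₂) β t) (x, 2)) +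
          chartCubic ρ₂ (circV (extZero (unscaleTE H (dimE ρ₂) β t)) (x, 1, 2)) (extZero (unscaleTE H (dimE ρ₂) β t) (x + Pi.single 2 1, 1))
            (extZero (unscaleTE H (dimE ρ₂) β t) (x, 2))) / 2)) := by
  simp only [extZero_unscaleTE_neg, circV_extZero_unscaleTE_neg, chartCubic_neg_neg_neg]
  ring

/-- **The quadratic surrogate of ONE plaquette is even in `t`** (a square of linear circulations). -/
theorem qObsD_neg (D : ℕ) (p : Plaq 4) (t : TSpaceD H D) : qObsD H D p (-t) = qObsD H D p t := by
  have hlin : ∀ i : Fin D, dirCirc H p ((-t) i) = -dirCirc H p (t i) := by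
    intro i
    rw [dirCirc_eq_sum, dirCirc_eq_sum, ← Finset.sum_neg_distrib]
    refine Finset.sum_congr rfl fun e _ => ?_
    simp only [Pi.neg_apply, WithLp.ofLp_neg, mul_neg]
  simp only [qObsD, hlin, neg_sq]

end Local

end Summit.QuantumFields.YangMills.Theorems.AllWindowsColdBoxBoxMidLine

end
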